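import Summits.NavierStokesRegularity.NavierStokesRegularity.Theorems.SwirlThresholdSwirlSupStrictDecreaseBarrier
import HarnessLib

/-!
# Spatial decay of the swirl along a bounded axisymmetric classical flow
# (support item `SwirlSupStrictDecrease`, route `SwirlThreshold`, stmt-NavierStokesRegularity-2004)

Helper file for the proof of `SwirlSupStrictDecrease`.  For a classical solution `(v, q)` of the
unforced Navier–Stokes system (`ν > 0`) on the closed slab `[0, T] × ℝ³` with bounded
(`|v| ≤ V`) axisymmetric velocity, the decay `|Γ₀(x)| (1 + |x|²) ≤ M` of the initial swirl
`Γ = x₀v₁ − x₁v₀` persists with an exponential-in-time constant: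
`|Γ(t, x)| (1 + |x|²) ≤ M e^{(6ν + V + 1) t}` (`abs_swirl_mul_le_of_classical`).

The proof is the barrier argument of `Literature.Analysis.FluidPDE.sign_mul_swirl_le_of_classical`
(Lei–Zhang 2017, (1.4); Lieberman 1996, Ch. II) with the constant `M` replaced by the decaying
supersolution `M e^{βt} (1 + |x|²)⁻¹` of the swirl operator `∂ₜ + v·∇ − ν(Δ − (2/r)∂ᵣ)`
(`barrier_subsolution` of the companion file `SwirlThresholdSwirlSupStrictDecreaseBarrier`):
for `h = e^{βt} (M (1 + |x|²)⁻¹ + ε (1 + |x|²))` one has `σΓ − h ≤ 0` on the parabolic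
boundary of `[0, T] × B̄(0, R)` minus the axis for `R ≥ 2V/ε` (`Γ = 0` on the axis,
`|Γ| ≤ 2|x||v|` on the sphere), hence `σΓ ≤ h` on `[0, T] × ℝ³` for every `ε > 0`.
-/

noncomputable section

-- the summit and its single problem share the name (D-0017 nested layout)
set_option linter.dupNamespace false

open Set Function Filter Topology MeasureTheory InnerProductSpace Metric WithLp
open scoped RealInnerProductSpace Laplacian ContDiff NNReal

namespace Summit.NavierStokesRegularity.NavierStokesRegularity.Theorems.SwirlSupStrictDecrease

open Literature.Analysis.FluidPDE

/-! ### The decay estimate -/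

/-- **One-sided decay comparison for the swirl.** Under the hypotheses of
`abs_swirl_mul_le_of_classical`, for a sign `σ = ±1`,
`σ Γ(t, x) ≤ M e^{(6ν+V+1)t} (1 + |x|²)⁻¹` on `[0, T] × ℝ³` (barrier argument, see the module
docstring; the weak maximum principle is `Literature.Analysis.FluidPDE.weak_max_principle`). -/
theorem sign_mul_swirl_le_decay_of_classical {T ν V M : ℝ} {v : ℝ → (EuclideanSpace ℝ (Fin 3)) → (EuclideanSpace ℝ (Fin 3))} {q : ℝ → (EuclideanSpace ℝ (Fin 3)) → ℝ}
    (hν : 0 < ν) (hT : 0 < T) (hcl : IsClassicalNSSolutionOn (Icc 0 T) ν 0 v q)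
    (haxi : ∀ t ∈ Icc 0 T, IsAxisymmetric (v t)) (hV : ∀ t ∈ Icc 0 T, ∀ x, ‖v t x‖ ≤ V)
    (hM : ∀ x, |swirl (v 0) x| * (1 + ‖x‖ ^ 2) ≤ M) {σ : ℝ} (hσ : σ = 1 ∨ σ = -1) :
    ∀ t ∈ Icc 0 T, ∀ x, σ * swirl (v t) x ≤ M * Real.exp ((6 * ν + V + 1) * t) * (1 + ‖x‖ ^ 2)⁻¹ := by
  have hV0 : 0 ≤ V := (norm_nonneg _).trans (hV 0 ⟨le_rfl, hT.le⟩ 0)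
  have hM0 : 0 ≤ M := by
    have := hM 0
    have h1 : 0 ≤ |swirl (v 0) 0| * (1 + ‖(0 : (EuclideanSpace ℝ (Fin 3)))‖ ^ 2) := by positivity
    linarith
  have hσabs : ∀ a : ℝ, σ * a ≤ |a| := fun a => by
    rcases hσ with h | h
    · rw [h, one_mul]; exact le_abs_self a
    · rw [h, neg_one_mul]; exact neg_le_abs a
  have hpos : ∀ y : (EuclideanSpace ℝ (Fin 3)), (0 : ℝ) < 1 + ‖y‖ ^ 2 := fun y => by positivity
  -- constants of the barrier
  set β : ℝ := 6 * ν + V + 1 with hβ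
  have hβ0 : 0 ≤ β := by rw [hβ]; positivity
  -- the claim for every `ε > 0`, on every large ball
  suffices key : ∀ ε : ℝ, 0 < ε → ∀ R : ℝ, 2 * V / ε ≤ R →
      ∀ t ∈ Icc 0 T, ∀ x ∈ closedBall (0 : (EuclideanSpace ℝ (Fin 3))) R,
        σ * swirl (v t) x -
          Real.exp (β * t) * (M * (1 + ‖x‖ ^ 2)⁻¹ + ε * (1 + ‖x‖ ^ 2)) ≤ 0 by
    intro t ht x
    refine le_of_forall_pos_le_add fun η hη => ?_
    set C : ℝ := Real.exp (β * t) * (1 + ‖x‖ ^ 2) with hC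
    have hCpos : 0 < C := by positivity
    have h := key (η / C) (div_pos hη hCpos) (max (2 * V / (η / C)) ‖x‖) (le_max_left _ _) t ht x
      (mem_closedBall_zero_iff.2 (le_max_right _ _))
    have e1 : Real.exp (β * t) * (η / C * (1 + ‖x‖ ^ 2)) = η := by
      rw [hC]
      field_simp
    have e : Real.exp (β * t) * (M * (1 + ‖x‖ ^ 2)⁻¹ + η / C * (1 + ‖x‖ ^ 2)) =
        M * Real.exp (β * t) * (1 + ‖x‖ ^ 2)⁻¹ + η := by
      rw [mul_add, e1]; ring
    rw [e] at h
    have hrw : (6 * ν + V + 1) * t = β * t := by rw [hβ]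
    rw [hrw]
    linarith
  intro ε hε R hR
  have hR0 : 0 ≤ R := le_trans (by positivity) hR
  -- the comparison function
  set w : ℝ → (EuclideanSpace ℝ (Fin 3)) → ℝ := fun t x =>
    σ * swirl (v t) x - Real.exp (β * t) * (M * (1 + ‖x‖ ^ 2)⁻¹ + ε * (1 + ‖x‖ ^ 2)) with hw
  set Γₜ : ℝ → (EuclideanSpace ℝ (Fin 3)) → ℝ := fun t x => timeDerivWithin (Icc 0 T) (fun s => swirl (v s)) t x with hΓₜ
  set wₜ : ℝ → (EuclideanSpace ℝ (Fin 3)) → ℝ := fun t x =>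
    σ * Γₜ t x - β * (Real.exp (β * t) * (M * (1 + ‖x‖ ^ 2)⁻¹ + ε * (1 + ‖x‖ ^ 2))) with hwₜ
  set K : Set (EuclideanSpace ℝ (Fin 3)) := closedBall 0 R with hK
  set U : Set (EuclideanSpace ℝ (Fin 3)) := ball 0 R ∩ {x | cylRadius x ≠ 0} with hU
  have hKc : IsCompact K := isCompact_closedBall _ _
  have hUo : IsOpen U := isOpen_ball.inter (isOpen_ne_fun continuous_cylRadius continuous_const)
  have hUK : U ⊆ K := fun x hx => ball_subset_closedBall hx.1
  -- regularity of the velocity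
  have hsm := hcl.smooth_velocity
  have hvC2 : ∀ t ∈ Icc 0 T, ContDiff ℝ 2 (v t) := fun t ht =>
    (hcl.contDiff_velocity ht).of_le (by norm_cast)
  -- (a) joint continuity
  have hc : ContinuousOn (uncurry w) (Icc 0 T ×ˢ K) := by
    have hvc : ContinuousOn (uncurry v) (Icc 0 T ×ˢ K) :=
      hsm.continuousOn.mono (prod_mono Subset.rfl (subset_univ _))
    have h1 : ContinuousOn (fun p : ℝ × (EuclideanSpace ℝ (Fin 3)) => ⟪rotGenL p.2, uncurry v p⟫) (Icc 0 T ×ˢ K) :=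
      (rotGenL.continuous.comp continuous_snd).continuousOn.inner hvc
    have h3 : Continuous fun p : ℝ × (EuclideanSpace ℝ (Fin 3)) => ((1 : ℝ) + ‖p.2‖ ^ 2)⁻¹ :=
      Continuous.inv₀ (by fun_prop) fun p => (hpos p.2).ne'
    have h2 : Continuous fun p : ℝ × (EuclideanSpace ℝ (Fin 3)) =>
        Real.exp (β * p.1) * (M * (1 + ‖p.2‖ ^ 2)⁻¹ + ε * (1 + ‖p.2‖ ^ 2)) := by
      fun_prop
    refine (((continuousOn_const (c := σ)).mul h1).sub h2.continuousOn).congr fun p _ => ?_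
    simp only [hw, uncurry, rotGenL_apply, swirl_eq_inner_rotGen, Pi.sub_apply, Pi.mul_apply]
  -- (b) smooth slices
  have h2 : ∀ t ∈ Ioc 0 T, ContDiff ℝ 2 (w t) := fun t ht =>
    (contDiff_const.mul (contDiff_swirl (hvC2 t ⟨ht.1.le, ht.2⟩))).sub (barrier_contDiff _ M ε)
  -- (c) the left time derivative
  have ht : ∀ t ∈ Ioc 0 T, ∀ x ∈ U, HasDerivWithinAt (fun s => w s x) (wₜ t x) (Icc 0 t) t := by
    intro t ht x _
    have htI : t ∈ Icc 0 T := ⟨ht.1.le, ht.2⟩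
    have hΓ : HasDerivWithinAt (fun s => swirl (v s) x) (Γₜ t x) (Icc 0 T) t := by
      have hd : DifferentiableWithinAt ℝ (fun s => swirl (v s) x) (Icc 0 T) t := by
        have h1 := hsm.differentiableWithinAt_time htI x
        simp only [swirl_eq_inner_rotGen]
        exact (differentiableWithinAt_const _).inner ℝ h1
      have := hd.hasDerivWithinAt
      simp only [hΓₜ, timeDerivWithin_apply]
      exact this
    have hexp : HasDerivWithinAt
        (fun s => Real.exp (β * s) * (M * (1 + ‖x‖ ^ 2)⁻¹ + ε * (1 + ‖x‖ ^ 2)))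
        ((Real.exp (β * t) * β) * (M * (1 + ‖x‖ ^ 2)⁻¹ + ε * (1 + ‖x‖ ^ 2))) (Icc 0 T) t := by
      have h1 : HasDerivAt (fun s => Real.exp (β * s)) (Real.exp (β * t) * β) t := by
        have := ((hasDerivAt_id t).const_mul β).exp
        simpa using this
      exact (h1.mul_const _).hasDerivWithinAt
    have h := ((hΓ.const_mul σ).sub hexp).mono (Icc_subset_Icc_right ht.2)
    simp only [hw, hwₜ]
    exact h.congr_deriv (by ring)
  -- (d) the sub-solution implication, from the swirl equation
  have hsub : ∀ t ∈ Ioc 0 T, ∀ x ∈ U, fderiv ℝ (w t) x = 0 → (Δ (w t)) x ≤ 0 → wₜ t x ≤ 0 :=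
    fun t ht x hx hgrad hlap =>
      barrier_subsolution hν hT hcl haxi hV hV0 hM0 hε hβ ht hx.2 hgrad hlap
  -- (e) the parabolic boundary: `t = 0`
  have hbot : ∀ x ∈ K, w 0 x ≤ 0 := by
    intro x _
    simp only [hw, mul_zero, Real.exp_zero, one_mul]
    have h1 := hσabs (swirl (v 0) x)
    have h2 : |swirl (v 0) x| ≤ M * (1 + ‖x‖ ^ 2)⁻¹ := by
      rw [← div_eq_mul_inv, le_div_iff₀ (hpos x)]
      exact hM x
    have h3 : 0 ≤ ε * (1 + ‖x‖ ^ 2) := by positivity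
    linarith
  -- (f) the parabolic boundary: the axis and the sphere `|x| = R`
  have hlat : ∀ t ∈ Icc 0 T, ∀ x ∈ K \ U, w t x ≤ 0 := by
    intro t ht x hx
    have hexp1 : 1 ≤ Real.exp (β * t) := Real.one_le_exp (mul_nonneg hβ0 ht.1)
    have hMq : 0 ≤ M * (1 + ‖x‖ ^ 2)⁻¹ := by positivity
    have hH : ε * (1 + ‖x‖ ^ 2) ≤
        Real.exp (β * t) * (M * (1 + ‖x‖ ^ 2)⁻¹ + ε * (1 + ‖x‖ ^ 2)) := by
      have h1 : (M * (1 + ‖x‖ ^ 2)⁻¹ + ε * (1 + ‖x‖ ^ 2)) * 1 ≤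
          (M * (1 + ‖x‖ ^ 2)⁻¹ + ε * (1 + ‖x‖ ^ 2)) * Real.exp (β * t) :=
        mul_le_mul_of_nonneg_left hexp1 (by positivity)
      linarith
    have hxK : ‖x‖ ≤ R := mem_closedBall_zero_iff.1 hx.1
    simp only [hw]
    by_cases hax : cylRadius x = 0
    · -- on the axis the swirl vanishes
      rw [swirl_eq_zero_of_cylRadius_eq_zero (v t) hax, mul_zero]
      have : 0 ≤ ε * (1 + ‖x‖ ^ 2) := by positivity
      linarith
    · -- on the sphere `|x| = R ≥ 2V/ε`
      have hxR : ‖x‖ = R := by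
        have hnot : x ∉ ball (0 : (EuclideanSpace ℝ (Fin 3))) R := fun hb => hx.2 ⟨hb, hax⟩
        have : R ≤ ‖x‖ := by simpa using hnot
        exact le_antisymm hxK this
      have h1 : σ * swirl (v t) x ≤ 2 * R * V := by
        refine (hσabs _).trans ?_
        calc |swirl (v t) x| ≤ 2 * ‖x‖ * ‖v t x‖ := abs_swirl_le_norm_mul (v t) x
          _ ≤ 2 * R * V := by
            rw [hxR]
            exact mul_le_mul_of_nonneg_left (hV t ht x) (by positivity)
      have h2 : 2 * R * V ≤ ε * (1 + ‖x‖ ^ 2) := by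
        rw [hxR]
        have : 2 * V ≤ ε * R := by
          rw [div_le_iff₀ hε] at hR; linarith
        nlinarith
      linarith
  exact weak_max_principle hKc hUo hUK hc h2 ht hsub hbot hlat

/-- **Persistence of spatial decay of the swirl** (strengthening of the maximum principle
`Literature.Analysis.FluidPDE.abs_swirl_le_of_classical`, Lei–Zhang 2017 (1.4), by a decaying
barrier): let `(v, q)` be a classical solution of the unforced Navier–Stokes system (`ν > 0`) on
`[0, T] × ℝ³` with bounded (`|v| ≤ V`) axisymmetric velocity. If `|Γ₀(x)| (1 + |x|²) ≤ M` then
`|Γ(t, x)| (1 + |x|²) ≤ M e^{(6ν + V + 1) t}` for all `(t, x) ∈ [0, T] × ℝ³`; in particular every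
slice `Γ(t, ·)` tends to `0` at spatial infinity. -/
theorem abs_swirl_mul_le_of_classical {T ν V M : ℝ} {v : ℝ → (EuclideanSpace ℝ (Fin 3)) → (EuclideanSpace ℝ (Fin 3))} {q : ℝ → (EuclideanSpace ℝ (Fin 3)) → ℝ}
    (hν : 0 < ν) (hT : 0 < T) (hcl : IsClassicalNSSolutionOn (Icc 0 T) ν 0 v q)
    (haxi : ∀ t ∈ Icc 0 T, IsAxisymmetric (v t)) (hV : ∀ t ∈ Icc 0 T, ∀ x, ‖v t x‖ ≤ V)
    (hM : ∀ x, |swirl (v 0) x| * (1 + ‖x‖ ^ 2) ≤ M) :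
    ∀ t ∈ Icc 0 T, ∀ x,
      |swirl (v t) x| * (1 + ‖x‖ ^ 2) ≤ M * Real.exp ((6 * ν + V + 1) * t) := by
  intro t ht x
  have hpos : (0 : ℝ) < 1 + ‖x‖ ^ 2 := by positivity
  have h1 := sign_mul_swirl_le_decay_of_classical hν hT hcl haxi hV hM (Or.inl rfl) t ht x
  have h2 := sign_mul_swirl_le_decay_of_classical hν hT hcl haxi hV hM (Or.inr rfl) t ht x
  rw [one_mul] at h1
  rw [neg_one_mul] at h2
  have h3 : |swirl (v t) x| ≤ M * Real.exp ((6 * ν + V + 1) * t) * (1 + ‖x‖ ^ 2)⁻¹ :=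
    abs_le.2 ⟨by linarith, h1⟩
  rw [← div_eq_mul_inv, le_div_iff₀ hpos] at h3
  exact h3

end Summit.NavierStokesRegularity.NavierStokesRegularity.Theorems.SwirlSupStrictDecrease

end
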